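import Mathlib
import HarnessLib
import HarnessLib.Audit
import Summits.NavierStokesRegularity.Statement
import Summits.NavierStokesRegularity.NavierStokesRegularity.Theses.RootDecompThresholdSaddle
import Summits.NavierStokesRegularity.NavierStokesRegularity.Theses.CoriolisHead
import Literature.Analysis.FluidPDE.SelfSimilar
import Literature.Analysis.FluidPDE.SelfSimilarLiouville
import Literature.Analysis.FluidPDE.TypeIAncientMild
import Literature.Analysis.FluidPDE.PineauVicolRSSHolds
import Literature.Analysis.FluidPDE.ChaeWolfRemovingDSSProofs
import HarnessLib.Audit.Status.Attr

/-!
Route: RootDecompFactorLadder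

# Route RootDecompFactorLadder — Tsai's Type-I DSS wall W cut by the FACTOR SET of the similarity
group, READ ON PINNED PAST-CONTINUOUS REPRESENTATIVES (rev 3, FAKE-BREATHER repair) — accumulating
factors (scaling solitons, attacked) and past-isolated factors (breathers, residual)

ROOT DECOMPOSITION CELL decomp-ns (D-0178), node N26 «THE FACTOR LADDER / NO SHRINKING BREATHERS»
(lens-1 g11; critic row 134), CHILD ROUTE of N15
`RootDecompThresholdSaddle` at the shared door W `TypeIDssWall` (stmt-29252 = Bradshaw–Tsai OP 5.1 /
Tsai Conj. 8.8–8.9). REV 3 = THE FAKE-BREATHER REPAIR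
(lens-1 g17, critic row 208 CERTIFIED MISSTATEMENT ACCEPTED): W's class (`IsAncientMildSolution 1
u`, measurable slices on t < 0, Type-I envelope) reads ONLY
the past of u while `IsRotatedDSS c R u` quantifies over ALL t, so the rev-1 residual B
`IsolatedFactorLiouville` (33310, «isolated factor set») is W ITSELF as
typed — glue a junk slice on t ≥ 0 that kills every factor in (1, c) (landed certificate
Theorems/RootDecompFactorLadderFakeBreather `isolated_iff_wall`,
`accumulating_of_isolated`: B ⟹ A, the rev-1 cut was void on the B side). B is retired ASIDE as a
settled costume edge (never reworded in place). THE REPAIRED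
CUT reads the symmetry dial where it is meaningful: on representatives PINNED (u = 0 on t ≥ 0, so an
RDSS identity on the past IS `IsRotatedDSS`,
`isRotatedDSS_of_Iio_of_eq_zero`) and JOINTLY CONTINUOUS on the open past (so the symmetry group is
an invariant of the slice-a.e. class, `eq_of_ae_eq_of_pinned`).
REG `TypeIRdssRepresentative` (27745, support, EXPECTED THEOREM = KNSS 2009 §4 /
Fabes–Jones–Rivière: every member of W's class is slice-a.e. equal to such a
representative with the same (c,R)-symmetry; implied by W with V := 0) moves each member to its
representative; then the honest excluded middle on «its
factor set accumulates at 1»: A `AccumulatingFactorLiouville` (33311, ATTACKED, split gen 1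
FOLD-OR-FLEE: Σ/E/C/P) kills the SCALING-SOLITON sector, B^R
`PastIsolatedFactorLiouville` (27744, crux rank 2, DECLARED RESIDUAL, UNDECIDED) kills the genuine
BREATHER sector (pinned, past-continuous members with a
factor c > 1 whose factor set is isolated from 1). EXACTNESS (lens §3, kernel): W ⟹ A, W ⟹ B^R, W ⟹
REG (drop binders / V := 0) and REG ∧ A ∧ B^R ⟹ W
(`wall_of_repaired`), i.e. W ⟺ A ∧ B^R modulo the expected theorem REG. It suffices to show X = K
`ThresholdSaddleConeRest` (N15's other binders R ∧ LBE ∧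
NMT ∧ PER, BY NAME) ∧ REG ∧ A ∧ B^R; `closes` rebuilds every rotated Type-I DSS Liouville statement
inline (representative, case split; plain conjunct = R = 1
via `rotatedTypeIDSSLiouville_refl_iff`) and feeds N15's born `closes`. THE LADDER beneath (asides):
NEAR `NearIdentityGap`, S `GapTransfer` (A ⟹ NEAR; PROVED
transfer from X₂ `TwoFactorExtraction` 26642, Theorems/RootDecompFactorLadderTwoFactorTransfer),
FLOOR `PureDssNearGap`, T♭ `FactorToCoriolis`. PIECE TAGS:
A WEAKER than W and than S, OPEN for middle speeds; B^R WEAKER than W (`pastIsolated_of_wall`),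
UNDECIDED, DECLARED RESIDUAL (habitat of a genuine large-factor
Type-I λ-DSS profile); REG WEAKER than W (`reg_of_wall`), EXPECTED THEOREM, first prover target; B
33310 ≡ W (aside, certified); bundle K = N15's items by name.
Honest COSTUME register: the seam is a representative change + one case split (`trivial_seam`);
per-piece probes A ↛ W, B^R ↛ W, REG ↛ W (BC7 CLEAN ×2 on the new
binders, writer fakebreather/bc/Probe.lean); the hard half B^R carries the graded plan NEAR/S/FLOOR
and the breather clock (lens §4: minimal factor,
`pastIsolated_iff_minimal`). PROVENANCE: lens HOME/decomp-ns-lens-1/FakeBreather.lean (652 lines, rc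
0, 0 sorry; critic probe rc1 = planted refusals only);
writer fakebreather/Sketch.lean (items verbatim + `closes'` + `pastIsolated_of_wall` +
`reg_of_wall`, rc 0, 0 sorry); landed certificates p781997
(TypeIDssWall_of_cells, N15 glue 31467 CLOSED) and Theorems/RootDecompFactorLadderFakeBreather (B ⟺
W, B ⟹ A, C ⟹ F, W ⟺ T ∧ C).
Lean: ThresholdSaddleConeRest ∧ TypeIRdssRepresentative ∧ AccumulatingFactorLiouville ∧
PastIsolatedFactorLiouville

## Assembly
X ⟹ S through N15's born `closes` BY NAME: K supplies R, LBE, NMT, PER; W is rebuilt inline — for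
each factor c, isometry R and member u, REG gives the pinned
past-continuous representative V with V =ᵐ u slice-wise; if V's factor set accumulates at 1, A; else
some (1, 1+ε) is factor-free and B^R; transport back along
V =ᵐ u; the plain conjunct is R = 1 via `rotatedTypeIDSSLiouville_refl_iff` — writer
fakebreather/glue.lean, certified `ledger route check --native --id … : OK`
(closes[route] OK, binders K, REG, A, B^R all consumed).

Rationale: WHY THIS LINE. Pineau–Vicol 2026 (arXiv:2607.09619, Remark 1.8 after Šverák: RSS = scaling solitons,
DSS/RDSS = breathers; Thms 1.6–1.7 = conditional «no shrinking
breathers» results in Perelman's spirit) prove two unconditional instances and NAME the conditional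
reading, but do not state the rotation-blind implication
«no solitons (all speeds) ⟹ no shrinking breathers (all twists)», which is S here, nor the exact
typed cut of the wall. The mechanism of S is the observation
that ANGLE TUNING IS UNNECESSARY once the soliton Liouville statement is phrased on accumulating
factor sets: powers c_n^(k_n) → μ for every μ > 1, rotations
extracted in the compact O(3), diagonal over a countable dense set of μ — the tree already holds the
engines (`RotatedDSSLimitStructure`,
`RotatedDSSWindowExtraction`, `PineauVicolRDSSCompactness`: `exists_limit_rdss_tuned`,
`typeI_rotatedDSS_structure_of_tendsto`, `exists_subseq_window_tendsto`).
Imported: Lie-group structure of closed subgroups of ℝ₊ × O(3) (Cartan; for T♯),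
compactness–rigidity near the identity of the similarity group (Chae–Wolf
2017 Thm 1.3, PV 1.7), the steady co-rotating profile equation (CoriolisHead). What it does that the
lineage did not: g7 graded W by envelope/ratio with a
rotation-blind cut but no piece carried the fine cell's obstruction (here: A; g7's F cell 31465
becomes «⟸ A» by S); g8–g10 graded by slice calmness / scar /
pressure sign (doors empty-by-theorem); lens-2's SYMMETRIC CORE (N24) cuts by SPATIAL stabilisers of
genuine blow-ups, not by the scaling projection of the
space–time symmetry group of ancient DSS members; CoriolisHead attacks PV Conj 1.1 head-on but is
not wired to W — T♭/T♯ wire it. REV 3 (FAKE BREATHER, lens-1 g17, critic row 208): the rev-1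
residual B was W in costume (junk extension on t ≥ 0); the repair reads the factor-set dial on
pinned past-continuous representatives (REG ∧ A ∧ B^R ⟺ W mod REG), which is where Bradshaw–Tsai /
Chae–Wolf / Pineau–Vicol actually work (classical fields on the open past).

RANKED CRUXES. #2 PastIsolatedFactorLiouville (crux) — B^R PAST-ISOLATED FACTOR LIOUVILLE (rev 3
repaired residual, stmt-27744; DECLARED RESIDUAL; UNDECIDED — never a prover target): every ancient
mild solution (ν = 1) with measurable slices, JOINTLY CONTINUOUS on the open past and PINNED (u = 0
on t ≥ 0), Type-I, (c,R)-rotated-DSS for some c > 1, R ∈ O(3), whose factor set is ISOLATED FROM 1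
(some l > 1 admits no factor in (1,l)) has a.e.-vanishing past slices — the genuine BREATHER sector;
the two new binders block the junk extension that made rev-1's B ≡ W (pinning:
`isRotatedDSS_of_Iio_of_eq_zero`; continuity: `eq_of_ae_eq_of_pinned`). WEAKER than W
(`pastIsolated_of_wall`) and than S; W ⟺ A ∧ B^R mod REG (`wall_iff_repaired`). [critic row 208; BC7
CLEAN] [difficulty: open-problem] (why it might fail: above the near-identity gap Λ_gap(C₀) no
Liouville theorem is known (`NearOneDssTypeIExclusion`: coarse ratio) — a large-factor Type-I λ-DSS
backward profile, the scenario Bradshaw–Tsai construct forward for L³_w data, would be pinned,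
past-continuous, with isolated factor set, and refute B^R.) [arXiv:1610.05680, arXiv:1610.09464,
arXiv:2607.09619, arXiv:0709.3599]
#3 AccumulatingFactorLiouville (crux) — A (ATTACKED; OPEN for middle angular speeds; IDEA-NEEDED;
corners PROVED): every ancient mild solution (ν = 1) with measurable slices and a Type-I envelope
whose FACTOR SET ACCUMULATES AT 1 (for every ε > 0 it is (c,R)-rotated-DSS for some 1 < c < 1 + ε, R
∈ O(3)) has a.e.-vanishing slices — the SCALING-SOLITON sector (smooth members: rotated self-similar
about an axis; M = 0: Leray self-similar) = Pineau–Vicol Conj. 1.1 ∩ Type I = CoriolisHead's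
`NoCoRotatingCore` 22676 modulo T♭/T♯. WEAKER than W (`accumulating_of_wall`; silent on breathers)
and than S; corners in the tree: self-similar members (`ScenarioCensus.row_D7cS_excluded`), speeds
|α| ≤ α₁ or ≥ α₂ (`pineauVicol2026_rss_liouville_holds`, PV Thm 1.4). [critic row 134 CLEARED]
[difficulty: XL] (why it might fail: for middle speeds α ≈ 1 the Coriolis term αJ breaks Tsai's
head-pressure maximum principle (PV p.4 «why Conjecture 1.1 is open for α ≠ 0») and no other
mechanism is known; a co-rotating Type-I self-similar profile at such a speed refutes A (and W, and
CoriolisHead).) [arXiv:2607.09619, arXiv:1610.05680, NecasRuzickaSverak1996]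
#9 ThresholdSaddleConeRest (support) — N15's other `closes` binders BY NAME (no new content; bundled
so that `closes` has three load-bearing binders): R `MarginalReduction` (25947, PROVED in tree) ∧
LBE `LeanBadDatumExists` (29109, PROVED) ∧ NMT `LeanThresholdIsTypeI` (29108; on N14 via N ∧ E) ∧
PER `ThresholdTangentPeriodicity` (29251; replaced on N18 by TAN ∧ DSS♭ ∧ ISO) — items of
route-NavierStokesRegularity-RootDecompThresholdSaddle / -RootDecompPointVertex, staffed THERE.
[difficulty: XL] (why it might fail: it inherits the lineage's open items NMT and PER (and N4's
blocker 1217 behind them); nothing new is claimed here.) [arXiv:1610.05680]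
#9 NearIdentityGap (support) — NEAR [aside] ROTATION-BLIND NEAR-IDENTITY GAP (rung; EXPECTED THEOREM
modulo A via S; PROVED sub-cells R = 1 (Chae–Wolf 2017 Thm 1.3), PV 2026 Thm 1.7 wedge/disc,
envelopes C₀⁴ < 1024/27): for every envelope constant C₀ there is a threshold Λ > 1 such that no
Type-I (constant C₀) ancient mild member is (c,R)-rotated-DSS with 1 < c < Λ, WHATEVER R ∈ O(3). W ⟺
NEAR ∧ B (lens `wall_iff_gap_and_isolated`); NEAR ⟹ A (logic, `accumulating_of_gap`); first OPEN
rung = the horn sectors α₁S < |θ| < α₂S, S = 2 log c ↓ 0. [difficulty: XL] (why it might fail: the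
horn sectors' compactness limit is a MIDDLE-SPEED soliton — NEAR at full strength is exactly as hard
as A there (S makes this precise); without A no rotation-blind gap is known.) [arXiv:1610.09464,
arXiv:2607.09619]
#9 GapTransfer (support) — S [aside] GAP TRANSFER (EXPECTED THEOREM, ATTACKABLE NOW — second prover
target): A ⟹ NEAR. Road: re-run the tree's rotated-DSS compactness extraction
(`exists_limit_rdss_tuned`, `typeI_rotatedDSS_structure_of_tendsto`, `exists_subseq_window_tendsto`)
with ARBITRARY R_n ∈ O(3) and NO angle tuning: if NEAR fails at C₀ there are nontrivial members with
factors c_n ↓ 1; the limit's factor set accumulates (powers c_n^(k_n) → μ for every μ > 1, rotations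
extracted in compact O(3), diagonal over countable dense μ, closedness of the RDSS relation under
local convergence), nontriviality as in Chae–Wolf Step 1, rotoreflections by O(3)-covariance; A
kills the limit. [deps: AccumulatingFactorLiouville, NearIdentityGap] [difficulty: L] (why it might
fail: nontriviality of the extracted limit needs a uniform lower bound at unit scale (Chae–Wolf Step
1 uses ε-regularity at the DSS scale, which degenerates as c_n ↓ 1 unless windows are re-chosen —
the tree's window extraction handles R = tuned rotations only).) [arXiv:1610.09464,
arXiv:2607.09619]
#9 PureDssNearGap (support) — FLOOR [aside] PURE-DSS NEAR GAP (KNOWN — FIRST PROVER TARGET, bc5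
witness of NEAR): for every C₀ there is Λ > 1 such that no Type-I (constant C₀) ancient mild member
with measurable slices is c-DSS (R = 1) with 1 < c < Λ — Chae–Wolf 2017 Thm 1.3
(`chaeWolf2017_removing_dss_holds`, classical typing) transported to the ancient-mild typing of W
(`TypeIAncientMildClassical`). NEAR ⟹ FLOOR (`pureDssNearGap_of_gap`). [difficulty: M] (why it might
fail: only the transport ancient-mild Type-I ⟹ classical on (−∞,0) × ℝ³ with the same envelope
stands between the tree's Chae–Wolf theorem and this typing; a gap in that transport
(measurable-slice hypothesis too weak for the mild formulation) would force a restatement.)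
[arXiv:1610.09464]
#9 FactorToCoriolis (support) — T♭ [aside] FACTOR ⟹ CORIOLIS (ATTACKABLE NOW): A implies
CoriolisHead's crux `NoCoRotatingCore` (stmt-22676): a rotated self-similar profile field pvAnsatz α
U is (c, rotZ(2α log c))-RDSS for EVERY c > 1 (`isRotatedDSS_pvAnsatz`), hence has an accumulating
factor set; classical Type-I ⟹ ancient mild (tree transport); then
`noCoRotatingCore_of_pineauVicolConjecture`. With the converse T♯ (Cartan closed-subgroup lemma for
ℝ₊ × O(3), library gap) A ≡ 22676. [deps: AccumulatingFactorLiouville] [difficulty: M] (why it might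
fail: routine modulo the classical ⟹ ancient-mild transport and the decay normalisation (1.9) of
PV's conjecture; the only risk is a mismatch between CoriolisHead's profile class and the Type-I
envelope class of A (profile decay vs envelope constant).) [arXiv:2607.09619]

#9 TypeIRdssRepresentative (support) — REG CLASSICAL PINNED REPRESENTATIVE (stmt-27745; EXPECTED
THEOREM, ATTACKABLE NOW — FIRST PROVER TARGET of rev 3; load-bearing binder of `closes`): every
member of W's class (ancient mild ν = 1, measurable slices, (c,R)-RDSS with c > 1, Type-I) is
slice-wise a.e. on the past equal to a member of the same class which is jointly continuous on the
open past, vanishes on t ≥ 0 and keeps the (c,R)-symmetry. Road: Type-I ⟹ bounded on every (−∞,−δ);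
bounded ancient mild ⟹ smooth (KNSS 2009 §4 Rem 4.1 / §6, Fabes–Jones–Rivière 1972 Thm 2.1; tree
pattern `TypeIAncientMildClassical`); RDSS identity to the continuous representative by
`Continuous.ae_eq_iff_eq`; cut off at t ≥ 0. CONSISTENT: W ⟹ REG with V := 0 (`reg_of_wall`). [BC7
CLEAN] [difficulty: M] (why it might fail: only via the Bochner-junk reading of
`IsAncientMildSolution` (slice-wise measurability, no joint measurability) — a junk member not a.e.
equal to a KNSS solution would break REG and W alike.) [arXiv:0709.3599, FabesJonesRiviere1972,
arXiv:1610.05680]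
#9 IsolatedFactorLiouville (aside) — B of rev 1 (stmt-33310): CERTIFIED MISSTATED, ≡ W 29252 as
typed (landed `isolated_iff_wall`; junk extension on t ≥ 0); kept as a settled costume edge, never
reworded in place, never staffed. [critic row 208]
#9 TwoFactorExtraction (aside) — X₂ (stmt-26642; EXPECTED THEOREM, KNSS Lemma 6.1 compactness +
window extraction + amplitude floor): serves only the aside S `GapTransfer` through the PROVED
transfer Theorems/RootDecompFactorLadderTwoFactorTransfer; banked context. [arXiv:2607.09619,
arXiv:1610.09464]

TWO-LAYER PLAN. Foreseen glued split of A (tenure, after T♭ lands): A ⟸ T♯ `CoriolisToFactor` ∧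
CoriolisHead.NoCoRotatingCore (lens `closesN15_viaCoriolis`), making the
dormant CoriolisHead route's crux the shared leaf; and of B^R by threshold / minimal factor (lens §4
`pastIsolated_iff_minimal`, breather clock): first cell at Λ_gap(C₀). Prover order: REG (expected
theorem) → FLOOR (known) → T♭ → S → NEAR's horn sectors conditional on A.

KILL CRITERIA. A co-rotating Type-I self-similar profile at a middle speed (refuting PV Conj. 1.1)
kills A, W, N15, N18 and CoriolisHead at once (`refuted:AccumulatingFactorLiouville`).
A certified large-factor Type-I DSS profile (isolated factor set) kills B^R and W
(`refuted:PastIsolatedFactorLiouville`) — the cut is exact, so either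
refutation retires the W lineage honestly. A failure of S as typed (non-trivial limit not
extractable without angle tuning) demotes NEAR to «⟸ A ∧ new
input» but kills nothing. A refutation of REG as typed (a junk member of the duality class with no
classical representative) is a TYPING finding on W's class (`refuted-misstated`), repaired by adding
joint measurability to W's class tree-wide, not a kill of the line.

NOT DECOMPOSED YET. NearFactorCell / FarFactorCell (threshold cells), T♯ `CoriolisToFactor` (library
gap: Cartan for ℝ₊ × O(3)), the identification A ≡ 22676, and the
per-threshold exactness W ⟺ ∀ C₀ NEAR(Λ C₀) ∧ FAR(Λ C₀) (lens `wall_iff_cells`) are NOT items at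
birth; the horn-sector rung of NEAR is prose, not an item. Rev 3: the breather clock /
minimal-factor form `PastMinimalFactorLiouville` (lens §4, ⟺ B^R) and C^R
`PastCoarseRatioLargeEnvelopeDssLiouville` (N15's repaired C) are NOT items here.

CHEAPEST FALSIFIER. `exact?` against the tree for A restricted to R = rotations about a fixed axis
with middle speed (should FAIL: only `pineauVicol2026_rss_liouville_holds`
small/large speeds and the self-similar row exist) — success would make A a citation; and the
one-line check that PV's ansatz is (c, rotZ(2α log c))-RDSS for
every c > 1 (`isRotatedDSS_pvAnsatz`, in tree) — if it failed, the identification «accumulating =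
soliton» and T♭ would be misstated. Rev 3: the BC7 probe of B^R / REG (writer
fakebreather/bc/Probe.lean, both CLEAN) and `reg_of_wall` (W ⟹ REG by V := 0, rc 0) — had REG not
followed from W the repaired cut would not be exact.

NUMBERS. Rev 3 items: cruxes B^R (r2) + A (r3, split gen 1 into Σ/E/C/P + glue CLOSED), supports K
(bundle) + REG, asides NEAR/S/FLOOR/T♭/B(33310 ≡ W)/X₂, 1 assembly; `closes` load-bearing binders 4
(K, REG, A, B^R), certified native OK; rev-1 numbers: items 8, binders 3; lens kernel 512 lines, 0
sorry, BC7 4/4 CLEAN (A, B, NEAR, S);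
writer Sketch rc 0, 0 sorry, Iff.rfl ×6; statement lengths A 477 / B 610 / NEAR 468 / FLOOR 412
chars; PV thresholds α₁ < α₂ (Thm 1.4), envelope cell
C₀⁴ < 1024/27 proved; W's dials to date: 6 (T∧F∧C, L∧Q∧Z, scar, Bernoulli, calm door, factor set).

DEFINITION REQUESTS. None: factor set, NearFactorCell, FarFactorCell are unfolded in the item
bodies; `IsRotatedDSS`, `IsDiscretelySelfSimilar`, `HasTypeIDecay`,
`IsAncientMildSolution`, `RotatedTypeIDSSLiouville`, `CoriolisHead.NoCoRotatingCore` are tree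
declarations.

Novelty: Searches RUN (lens-1 g11, 2026-08-30, both corpora, labelled; writer re-checked the tree: rg
`AccumulatingFactor|IsolatedFactor|factor set|NearIdentityGap` in
Theses/ Theorems/ → no hit outside the lens; `ScenarioCensus` Row_D7cR is the only twist-structured
row): `lit search --hybrid "rotated discretely self-similar
Liouville backward Navier-Stokes scaling factor close to one"` (8 docs; hit [corpus:arxiv-2607.09619
pp.1,6,7]; Lemarié-Rieusset 2016 ch. on self-similarity
pp.14,638,781 — no factor-set / soliton-breather cut) ; `lit galaxy search "shrinking
breather|rotated self-similar|discretely self-similar" --star all` (24 rows: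
Perelman 2002 [galaxy:pdf:-115635158407650440]; Bradshaw MWPDE abstract
[galaxy:pdf:5756072837513326460] (forward DSS data); Choptuik-type critical-collapse DSS
«echoing period» papers [galaxy:pdf:214546959395946500], [galaxy:pdf:832072820] — the physics
instance of an ISOLATED factor set; Chow, Ricci solitons
[galaxy:panama:275376123150431]); lean search / rg: RotatedDSSLimitStructure,
RotatedDSSWindowExtraction, PineauVicolRDSSCompactness (engine of S present; no
statement of S, A, B or NEAR in Theses/Theorems). Nearest prior art FOUND: Pineau–Vicol 2026 Remark
1.8 [corpus:arxiv-2607.09619 p.7 L40–49, p.8 L1–3] and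
Thm 1.7 [corpus:arxiv-2607.09619 p.7]; Chae–Wolf 2017 Thm 1.3 (arXiv:1610.09464); in the tree: N15
rev 1 / N18 rev 2–3 dials, CoriolisHead 22676/22677,
ScenarioCensus rows D6a/D6b/D6g/D7cS/D7cR (sub-cells, none is A, B or NEAR). Delta i  [refs: 1610.09464, arxiv-2607.09619]

Barriers (technique_class: similarity-group structure, compactness-rigidity near 1): - technique_class: symmetry-group structure (factor set of the similarity group ℝ₊ × O(3)) +
compactness-rigidity near the identity (Chae–Wolf / Pineau–Vicol); rotated-self-similar Liouville as
the attacked leaf; no a-priori estimate.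
- Literature.Barriers.NavierStokesRegularity.NearOneDssTypeIExclusion: NEAR and S sit INSIDE its
class and USE it (they extend Chae–Wolf 1.3 / PV 1.9 to all twists modulo A); B sits exactly where
the barrier says «coarse ratio: no Liouville theorem known» — declared residual,
requires-beating-barrier: it does; the bet is that A + S shrink B to the far cells and that a
breather-specific invariant (minimal factor, Floquet structure of the period map) is the next dial;
A is OUTSIDE the class (steady problem; the barrier quantifies over periods S > 0).
- Literature.Barriers.NavierStokesRegularity.LeraySelfSimilarBlowupExclusion: A's α = 0 corner IS
this barrier's theorem (NRŠ 1996 / Tsai 1998); A for α ≠ 0 is outside its class (the Coriolis term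
αJ breaks Tsai's head-pressure maximum principle — PV p.4; CoriolisHead's counter-rotating Liouville
22677 PROVED the signed-defect sub-case).
- Literature.Barriers.NavierStokesRegularity.AxisymmetricTypeIExclusion: handles the degenerate
branch of the closed-subgroup lemma (a continuous family of pure rotations in the symmetry group ⟹
axisymmetric member ⟹ excluded by KNSS / Seregin–Šverák 2009); not load-bearing.
- Literature.Barriers.NavierStokesRegularity.AveragedTypeIBlowup: the SEAM is abstract logic,

sub-problem: NavierStokesRegularity · status: draft · opened planner-decomp-ns-writer-1-g5-0 2026-08-30T13:22:22Z · rev 4 · ledger route-NavierStokesRegularity-RootDecompFactorLadder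
GENERATED by the gate from the ledger (D-0016/17). Provers cite these decls: `theorem foo : Summit.NavierStokesRegularity.NavierStokesRegularity.Theses.RootDecompFactorLadder.<Decl> := …` in Summits/NavierStokesRegularity/NavierStokesRegularity/Theorems/<Name>.lean.
-/

namespace Summit.NavierStokesRegularity.NavierStokesRegularity.Theses.RootDecompFactorLadder

open scoped BigOperators Topology Manifold Classical MeasureTheory ProbabilityTheory Matrix InnerProductSpace ComplexConjugate ContinuousMap
open Filter Set Function TopologicalSpace MeasureTheory

attribute [summit_statement] _root_.NavierStokesRegularity

open Literature.NS

/-- item stmt-NavierStokesRegularity-27744 · crux · rank 2 · open · by planner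
why it might fail: a large-factor Type-I λ-DSS backward profile (the scenario Bradshaw–Tsai construct forward for L³_w data; no Liouville theorem above the near-identity gap, Chae–Wolf needs λ−1 small) would be pinned, past-continuous, with isolated factor set, and refute it.
sources: arXiv:1610.05680, arXiv:1610.09464, arXiv:2607.09619, arXiv:0709.3599
[crux] B^R «PAST-ISOLATED FACTOR LIOUVILLE» (repaired B 33310 — lens-1 g17 THE FAKE BREATHER, critic
row 208 CERTIFIED MISSTATEMENT: B 33310 ≡ W 29252 as typed,
Theorems/RootDecompFactorLadderFakeBreather isolated_iff_wall; DECLARED RESIDUAL of N26; UNDECIDED;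
never reword 33310 in place — it stays as a settled costume edge, aside): every ancient mild
solution (ν = 1) with measurable slices which is JOINTLY CONTINUOUS on the past and PINNED (u = 0 on
t ≥ 0), Type-I, (c,R)-rotated-DSS for some c > 1, R ∈ O(3), and whose rotated-DSS factor set is
ISOLATED from 1 (some l > 1 admits no factor in (1,l)), has a.e.-vanishing past slices — the genuine
BREATHER sector. The two new binders block the junk witness (exists_junk_extension): pinning makes
the RDSS identity a statement about the past (isRotatedDSS_of_Iio_of_eq_zero) and joint continuity
makes the symmetry group an invariant of the a.e.-class (eq_of_ae_eq_of_pinned). WEAKER than W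
(pastIsolated_of_wall: drop binders); exactness W ⟺ A ∧ B^R modulo REG (lens wall_iff_repaired);
silent on solitons (accumulating factor sets are A 33311). Why it might fail: a large-factor Type-I
λ-DSS backward profile — the scenario Bradshaw–Tsai constr -/
@[route_item "route-NavierStokesRegularity-RootDecompFactorLadder", crux]
def PastIsolatedFactorLiouville : Prop :=
  ∀ (c : ℝ) (R : EuclideanSpace ℝ (Fin 3) ≃ₗᵢ[ℝ] EuclideanSpace ℝ (Fin 3)) (u : ℝ → EuclideanSpace ℝ (Fin 3) → EuclideanSpace ℝ (Fin 3)), 1 < c → Literature.Analysis.FluidPDE.IsAncientMildSolution 1 u → (∀ t : ℝ, t < 0 → MeasureTheory.AEStronglyMeasurable (u t) MeasureTheory.volume) → ContinuousOn (Function.uncurry u) (Set.Iio 0 ×ˢ Set.univ) → (∀ t : ℝ, 0 ≤ t → u t = 0) → Literature.Analysis.FluidPDE.IsRotatedDSS c R u → (∃ C₀ : ℝ, Literature.Analysis.FluidPDE.HasTypeIDecay C₀ u) → (∃ l : ℝ, 1 < l ∧ ∀ (c' : ℝ) (R' : EuclideanSpace ℝ (Fin 3) ≃ₗᵢ[ℝ]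 EuclideanSpace ℝ (Fin 3)), 1 < c' → c' < l → ¬ Literature.Analysis.FluidPDE.IsRotatedDSS c' R' u) → ∀ t : ℝ, t < 0 → u t =ᵐ[MeasureTheory.volume] 0

/-- item stmt-NavierStokesRegularity-33311 · crux · rank 3 · SPLIT (gen 1) into SpinStructure, UniformEnvelope, ClosedBadSpeeds, SpeedPersistence + glue AccumulatingFactorLiouville_of_pieces · direct attempts still welcome (low priority) · by planner
why it might fail: for middle speeds α ≈ 1 the Coriolis term αJ breaks Tsai's head-pressure maximum principle (PV p.4 «why Conjecture 1.1 is open for α ≠ 0») and no other mechanism is known; a co-rotating Type-I self-similar profile at such a speed refutes A (and W, and CoriolisHead).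
sources: arXiv:2607.09619, arXiv:1610.05680, NecasRuzickaSverak1996
[crux] A (ATTACKED; OPEN for middle angular speeds; IDEA-NEEDED; corners PROVED): every ancient mild
solution (ν = 1) with measurable slices and a Type-I envelope whose FACTOR SET ACCUMULATES AT 1 (for
every ε > 0 it is (c,R)-rotated-DSS for some 1 < c < 1 + ε, R ∈ O(3)) has a.e.-vanishing slices —
the SCALING-SOLITON sector (smooth members: rotated self-similar about an axis; M = 0: Leray
self-similar) = Pineau–Vicol Conj. 1.1 ∩ Type I = CoriolisHead's `NoCoRotatingCore` 22676 modulo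
T♭/T♯. WEAKER than W (`accumulating_of_wall`; silent on breathers) and than S; corners in the tree:
self-similar members (`ScenarioCensus.row_D7cS_excluded`), speeds |α| ≤ α₁ or ≥ α₂
(`pineauVicol2026_rss_liouville_holds`, PV Thm 1.4). [critic row 134 CLEARED] [difficulty: XL] -/
@[route_item "route-NavierStokesRegularity-RootDecompFactorLadder", crux]
def AccumulatingFactorLiouville : Prop :=
  ∀ (u : ℝ → EuclideanSpace ℝ (Fin 3) → EuclideanSpace ℝ (Fin 3)), Literature.Analysis.FluidPDE.IsAncientMildSolution 1 u → (∀ t : ℝ, t < 0 → MeasureTheory.AEStronglyMeasurable (u t) MeasureTheory.volume) → (∃ C₀ : ℝ, Literature.Analysis.FluidPDE.HasTypeIDecay C₀ u) → (∀ ε : ℝ, 0 < ε → ∃ (c : ℝ) (R : EuclideanSpace ℝ (Fin 3) ≃ₗᵢ[ℝ] EuclideanSpace ℝ (Fin 3)), 1 < c ∧ c < 1 + ε ∧ Literature.Analysis.FluidPDE.IsRotatedDSS c R u) → ∀ t : ℝ, t < 0 → u t =ᵐ[MeasureTheory.volume] 0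

-- parent: AccumulatingFactorLiouville · child (gen 1)
/--     item stmt-NavierStokesRegularity-33913 · crux · rank 302 · open
    parent: AccumulatingFactorLiouville · by planner
    why it might fail: a branch of middle-speed profiles whose envelope constants blow up towards its end speeds is consistent with everything known (forward self-similar branches grow without bound in their parameter, Jia–Šverák 2014); nothing bounds sup_y (1+|y|)|U(y)| a priori.
    sources: arXiv:2607.09619, arXiv:1204.0529, Tsai1998
[crux] E UNIFORM ENVELOPE «no counterexample FLEES» (layer-2 piece 2 of A 33311 · rank 3 · DECLARED
RESIDUAL of this split · UNDECIDED · IDEA-NEEDED · decided below the Chae–Wolf floor (rung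
exists_floor_bad_eq_empty)): ONE constant C⋆ is a Type-I envelope for EVERY classical Type-I rotated
self-similar field u = pvAnsatz α U on the open past: ‖u(t,x)‖ ≤ C⋆/(‖x‖ + √−t), whatever its own
envelope C and speed α (vacuous at the corners |α| < α₁(C), |α| > α₂(C); in the middle an a-priori
estimate for the profile system PV (1.8) uniform in α). [lens-1 g15, SpeedContinuation.lean :278;
critic row 174] -/
@[route_item "route-NavierStokesRegularity-RootDecompFactorLadder", crux]
def UniformEnvelope : Prop :=
  ∃ Cs : ℝ, ∀ (C α : ℝ) (U : EuclideanSpace ℝ (Fin 3) → EuclideanSpace ℝ (Fin 3)) (p : ℝ → EuclideanSpace ℝ (Fin 3) → ℝ), Literature.Analysis.FluidPDE.IsClassicalNSSolutionOn (Set.Iio 0) 1 0 (Literature.Analysis.FluidPDE.pvAnsatz α (fun y _ => U y)) p → Literature.Analysis.FluidPDE.HasTypeIDecay C (Literature.Analysis.FluidPDE.pvAnsatz α (fun y _ => U y)) → Literature.Analysis.FluidPDE.HasTypeIDecay Cs (Literature.Analysis.FluidPDE.pvAnsatz α (fun y _ => U y))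

-- parent: AccumulatingFactorLiouville · child (gen 1)
/--     item stmt-NavierStokesRegularity-33915 · crux · rank 304 · open
    parent: AccumulatingFactorLiouville · by planner
    why it might fail: if a middle branch exists at all it is generically an ISOLA whose extreme speeds are folds (degenerate profiles) — forward self-similar families do bifurcate in their parameter numerically (Guillod–Šverák 2017); P is expected true only together with RSS Liouville itself.
    sources: arXiv:2607.09619, arXiv:1204.0529, arXiv:1704.00560, doi:10.1016/0022-1236(71)90015-2
[crux] P SPEED PERSISTENCE «no counterexample sits at a FOLD» (layer-2 piece 4 of A 33311 · rank 2 ·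
DECLARED RESIDUAL of this split · the LEVER of the node · UNDECIDED · IDEA-NEEDED · decided below
the Chae–Wolf floor (rung speedPersistence_rung)): a speed carried by a nontrivial classical Type-I
RSS member of envelope C is INTERIOR to the bad-speed set of every larger envelope C′ > C —
nontrivial profiles continue to all nearby speeds with envelope as close to C as we please. Planned
(layer 3, NOT filed): P ⟸ NONDEG (the linearised Leray–Coriolis operator at a nontrivial Type-I
profile has no decaying kernel beyond the rotation mode — a LINEAR Liouville problem, profile by
profile) ∧ IFT (equivariant implicit function theorem in a (1+|y|)-weighted C² class). With Σ, E, C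
and the tree's corner α = 0 (Pineau–Vicol Thm 1.4), FOLD OR FLEE (closed ∧ open ∧ confined ∧ corner
⟹ empty; ℝ connected) gives RSS Liouville at all speeds, hence A. [lens-1 g15,
SpeedContinuation.lean :326; critic row 174] -/
@[route_item "route-NavierStokesRegularity-RootDecompFactorLadder", crux]
def SpeedPersistence : Prop :=
  ∀ C C' : ℝ, C < C' → {α : ℝ | ∃ (U : EuclideanSpace ℝ (Fin 3) → EuclideanSpace ℝ (Fin 3)) (p : ℝ → EuclideanSpace ℝ (Fin 3) → ℝ), (Literature.Analysis.FluidPDE.IsClassicalNSSolutionOn (Set.Iio 0) 1 0 (Literature.Analysis.FluidPDE.pvAnsatz α (fun y _ => U y)) p ∧ Literature.Analysis.FluidPDE.HasTypeIDecay C (Literature.Analysis.FluidPDE.pvAnsatz α (fun y _ => U y))) ∧ U ≠ 0} ⊆ interior {α : ℝ | ∃ (U : EuclideanSpace ℝ (Fin 3) → EuclideanSpace ℝ (Fin 3)) (p : ℝ → EuclideanSpace ℝ (Fin 3) → ℝ), (Literature.Analysis.FluidPDE.IsClassicalNSSolutionOn (Set.Iio 0) 1 0 (Literature.Analysis.FluidPDE.pvAnsatz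 α (fun y _ => U y)) p ∧ Literature.Analysis.FluidPDE.HasTypeIDecay C' (Literature.Analysis.FluidPDE.pvAnsatz α (fun y _ => U y))) ∧ U ≠ 0}

-- parent: AccumulatingFactorLiouville · child (gen 1)
/--     item stmt-NavierStokesRegularity-33912 · support · rank 301 · open
    parent: AccumulatingFactorLiouville · by planner
    sources: arXiv:0709.3599, arXiv:2607.09619
[support] Σ SPIN STRUCTURE (layer-2 piece 1 of A 33311 · KNOWN-type (É. Cartan closed-subgroup
theorem for the symmetry group {(log c, R)} ≤ ℝ × O(3) of a continuous field: scale projection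
accumulating at 0 ⟹ dense ⟹ all of ℝ ⟹ a one-parameter subgroup (s, e^{sξ}); KNSS 2009 §4: Type-I
ancient mild fields are classical on the past; RSS at all scales ⟹ Pineau–Vicol ansatz form with
profile u(−1,·) about the axis of ξ, conjugated to e₃ by O(3)-covariance) · NOT IN TREE ·
ATTACKABLE, size L · second prover target): every member of A's class (ancient mild, measurable
slices, Type-I, rotated-DSS factors accumulating at 1) is a.e. trivial on the past OR is, slice-wise
a.e. and after an isometric change of axes Q, a NONTRIVIAL classical Type-I Pineau–Vicol RSS field
pvAnsatz α U. Why it might fail: only as typed — the a.e./pointwise bookkeeping between the mild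
class and the classical representative. [lens-1 g15 FOLD OR FLEE, SpeedContinuation.lean :252;
critic row 174 CLEARED; sources arXiv:0709.3599 §4, arXiv:2607.09619] -/
@[route_item "route-NavierStokesRegularity-RootDecompFactorLadder", crux]
def SpinStructure : Prop :=
  ∀ (u : ℝ → EuclideanSpace ℝ (Fin 3) → EuclideanSpace ℝ (Fin 3)), Literature.Analysis.FluidPDE.IsAncientMildSolution 1 u → (∀ t : ℝ, t < 0 → MeasureTheory.AEStronglyMeasurable (u t) MeasureTheory.volume) → (∃ C₀ : ℝ, Literature.Analysis.FluidPDE.HasTypeIDecay C₀ u) → (∀ ε : ℝ, 0 < ε → ∃ (c : ℝ) (R : EuclideanSpace ℝ (Fin 3) ≃ₗᵢ[ℝ] EuclideanSpace ℝ (Fin 3)), 1 < c ∧ c < 1 + ε ∧ Literature.Analysis.FluidPDE.IsRotatedDSS c R u) → (∀ t : ℝ, t < 0 → u t =ᵐ[MeasureTheory.volume] 0) ∨ ∃ (Q : EuclideanSpace ℝ (Fin 3) ≃ₗᵢ[ℝ] EuclideanSpace ℝ (Fin 3)) (C α : ℝ) (U : EuclideanSpace ℝ (Fin 3) → EuclideanSpace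 ℝ (Fin 3)) (p : ℝ → EuclideanSpace ℝ (Fin 3) → ℝ), U ≠ 0 ∧ Literature.Analysis.FluidPDE.IsClassicalNSSolutionOn (Set.Iio 0) 1 0 (Literature.Analysis.FluidPDE.pvAnsatz α (fun y _ => U y)) p ∧ Literature.Analysis.FluidPDE.HasTypeIDecay C (Literature.Analysis.FluidPDE.pvAnsatz α (fun y _ => U y)) ∧ ∀ t : ℝ, t < 0 → u t =ᵐ[MeasureTheory.volume] fun x => Q.symm (Literature.Analysis.FluidPDE.pvAnsatz α (fun y _ => U y) t (Q x))

-- parent: AccumulatingFactorLiouville · child (gen 1)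
/--     item stmt-NavierStokesRegularity-33914 · support · rank 303 · open
    parent: AccumulatingFactorLiouville · by planner
    sources: arXiv:2607.09619, arXiv:1610.09464, arXiv:0709.3599
[support] C CLOSED BAD SPEEDS «the dial lives in the equation» (layer-2 piece 3 of A 33311 ·
EXPECTED THEOREM · ATTACKABLE NOW · FIRST PROVER TARGET, size L · decided below the Chae–Wolf floor
(rung closedBadSpeeds_rung)): at each fixed envelope C the set of speeds α carried by a NONTRIVIAL
classical Type-I RSS field pvAnsatz α U of envelope C is closed in ℝ. Road (all engines in the
tree): αₙ → α⋆ with nontrivial members Uₙ; ChaeWolf.exists_uniform_lipschitz + Arzelà–Ascoli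
(PineauVicol2026.exists_limit_rss with rotation angles θₙ = 2αₙ log μ → 2α⋆ log μ:
tendsto_rotZ_of_tendsto, rotatedDSS_Iio_of_tendsto); the limit is Type-I with the same C
(HasTypeIDecay.of_tendsto), RSS of speed α⋆, NONTRIVIAL (ChaeWolf.exists_eps_typeI_small_eq_zero:
each Uₙ exceeds ε₀ at ‖yₙ‖ ≤ C/ε₀; if the mass escapes |yₙ| → ∞ the critic's remark: |uₙ(eₙ,tₙ)| ≳ ε
at |eₙ| = 1, tₙ → 0⁻, backward parabolic C^k bounds up to t = 0⁻ give a nontrivial locally uniform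
limit), ancient mild (AncientMildCompactness) hence classical (TypeIAncientMildClassical, KNSS 2009
§4). Why it might fail: only the C²-upgrade of the limit profile inside the tree's typing (known:
Serrin 1962; KNSS 2009 §4). [lens-1 g15, SpeedContin -/
@[route_item "route-NavierStokesRegularity-RootDecompFactorLadder", crux]
def ClosedBadSpeeds : Prop :=
  ∀ C : ℝ, IsClosed {α : ℝ | ∃ (U : EuclideanSpace ℝ (Fin 3) → EuclideanSpace ℝ (Fin 3)) (p : ℝ → EuclideanSpace ℝ (Fin 3) → ℝ), (Literature.Analysis.FluidPDE.IsClassicalNSSolutionOn (Set.Iio 0) 1 0 (Literature.Analysis.FluidPDE.pvAnsatz α (fun y _ => U y)) p ∧ Literature.Analysis.FluidPDE.HasTypeIDecay C (Literature.Analysis.FluidPDE.pvAnsatz α (fun y _ => U y))) ∧ U ≠ 0}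

-- parent: AccumulatingFactorLiouville · glue (gen 1)
/--     item stmt-NavierStokesRegularity-33916 · support · rank 305 · closed · proved by Summit.NavierStokesRegularity.NavierStokesRegularity.Theorems.RootDecompFactorLadderFoldOrFlee.accumulatingFactorLiouville_of_pieces_proof (planner)
    parent: AccumulatingFactorLiouville · GLUE: children ⟹ parent · by planner
SpinStructure → UniformEnvelope → ClosedBadSpeeds → SpeedPersistence → AccumulatingFactorLiouville:
FOLD OR FLEE — E (confined) ∧ C (closed) ∧ P (open) ∧ the tree corner α = 0
(pineauVicol2026_rss_liouville_holds) make every bad-speed level empty (ℝ connected), i.e. RSS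
Liouville at all speeds; Σ changes language (speed → factor). Lens-1 g15 A_of_pieces, exact A ⟺ Σ ∧
E ∧ C ∧ P (A_iff_pieces); writer Sketch foldflee/Sketch.lean rc 0 (bodies Iff.rfl vs lens; glue,
exactness and Chae–Wolf rungs re-proved on the one-line items) -/
@[route_item "route-NavierStokesRegularity-RootDecompFactorLadder"]
def AccumulatingFactorLiouville_of_pieces : Prop :=
  SpinStructure → UniformEnvelope → ClosedBadSpeeds → SpeedPersistence → AccumulatingFactorLiouville

-- `AccumulatingFactorLiouville_of_pieces` holds: proved by `Summit.NavierStokesRegularity.NavierStokesRegularity.Theorems.RootDecompFactorLadderFoldOrFlee.accumulatingFactorLiouville_of_pieces_proof` (its module imports this route file, so no `_holds` link can be stated here).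

/-- item stmt-NavierStokesRegularity-33310 · aside · rank 2 · open · by planner
why it might fail: above the near-identity gap Λ_gap(C₀) no Liouville theorem is known (`NearOneDssTypeIExclusion`: coarse ratio) — a large-factor Type-I DSS profile, the scenario Bradshaw–Tsai construct forward for L³_w data, would have an isolated factor set and refute B.
sources: arXiv:1610.05680, arXiv:1610.09464, arXiv:2607.09619
[crux] B (DECLARED RESIDUAL; UNDECIDED/BARRIER — never a prover target): every ancient mild solution
(ν = 1) with measurable slices and a Type-I envelope which is (c,R)-rotated-DSS for some c > 1, R ∈
O(3), and whose factor set is ISOLATED FROM 1 (some l > 1 admits no factor in (1,l)) has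
a.e.-vanishing slices — the BREATHER sector. WEAKER than W (`isolated_of_wall`; B says nothing about
solitons, B ⟹ W is exactly A) and than S; habitat of a genuine Type-I λ-DSS blow-up profile with λ
large. [critic row 134 CLEARED; census v10 C01] [difficulty: open-problem] -/
@[route_item "route-NavierStokesRegularity-RootDecompFactorLadder", crux]
def IsolatedFactorLiouville : Prop :=
  ∀ (c : ℝ) (R : EuclideanSpace ℝ (Fin 3) ≃ₗᵢ[ℝ] EuclideanSpace ℝ (Fin 3)) (u : ℝ → EuclideanSpace ℝ (Fin 3) → EuclideanSpace ℝ (Fin 3)), 1 < c → Literature.Analysis.FluidPDE.IsAncientMildSolution 1 u → (∀ t : ℝ, t < 0 → MeasureTheory.AEStronglyMeasurable (u t) MeasureTheory.volume) → Literature.Analysis.FluidPDE.IsRotatedDSS c R u → (∃ C₀ : ℝ, Literature.Analysis.FluidPDE.HasTypeIDecay C₀ u) → (∃ l : ℝ, 1 < l ∧ ∀ (c' : ℝ) (R' : EuclideanSpace ℝ (Fin 3) ≃ₗᵢ[ℝ] EuclideanSpace ℝ (Fin 3)), 1 < c' → c' < l → ¬ Literature.Analysis.FluidPDE.IsRotatedDSS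 c' R' u) → ∀ t : ℝ, t < 0 → u t =ᵐ[MeasureTheory.volume] 0

/-- item stmt-NavierStokesRegularity-26642 · aside · rank 9 · open · by planner
[support] X₂ «TWO-FACTOR EXTRACTION» (lens-1 g12 TWO TUNINGS; critic row 174 (iv) optional): a
sequence of NONTRIVIAL members of W’s class with a common Type-I envelope C₀, each rotated-DSS with
some factor in (1, 2], carrying symmetries (aₙ, Rₙ) and (bₙ, Sₙ) with aₙ → 2 and bₙ → 3 (isometries
arbitrary), admits a NONTRIVIAL member of W’s class (some envelope) which is (2, R′)-RDSS and (3,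
S′)-RDSS. EXPECTED THEOREM (KNSS Lemma 6.1 Type-I compactness + window extraction + amplitude floor
at t = −1), ATTACKABLE NOW; WEAKER than W (twoFactorExtraction_of_wall). PROVED transfer X₂ ⟹ S
GapTransfer 33314 landed by the writer (Theorems/RootDecompFactorLadderTwoFactorTransfer.lean). Why
it might fail: loss of non-triviality in the limit without the amplitude floor (handled by
exists_eps_typeI_small_eq_zero). Sources: PineauVicol2026, ChaeWolf2019, KNSS2009 Lemma 6.1; lens
HOME/decomp-ns-lens-1/TwoTunings.lean :440. -/
@[route_item "route-NavierStokesRegularity-RootDecompFactorLadder"]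
def TwoFactorExtraction : Prop :=
  ∀ (C₀ : ℝ) (u : ℕ → ℝ → EuclideanSpace ℝ (Fin 3) → EuclideanSpace ℝ (Fin 3)) (a b : ℕ → ℝ) (R S : ℕ → EuclideanSpace ℝ (Fin 3) ≃ₗᵢ[ℝ] EuclideanSpace ℝ (Fin 3)), (∀ n, Literature.Analysis.FluidPDE.IsAncientMildSolution 1 (u n)) → (∀ n, ∀ t : ℝ, t < 0 → MeasureTheory.AEStronglyMeasurable (u n t) MeasureTheory.volume) → (∀ n, Literature.Analysis.FluidPDE.HasTypeIDecay C₀ (u n)) → (∀ n, ¬ ∀ t : ℝ, t < 0 → u n t =ᵐ[MeasureTheory.volume] 0) → (∀ n, ∃ (c : ℝ) (Q : EuclideanSpace ℝ (Fin 3) ≃ₗᵢ[ℝ] EuclideanSpace ℝ (Fin 3)), 1 < c ∧ c ≤ 2 ∧ Literature.Analysis.FluidPDE.IsRotatedDSS c Q (u n)) → (∀ n, Literature.Analysis.FluidPDE.IsRotatedDSS (a n) (R n) (u n)) → (∀ n, Literature.Analysis.FluidPDE.IsRotatedDSS (b n) (S n) (u n)) → Filter.Tendsto a Filter.atTop (nhds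 2) → Filter.Tendsto b Filter.atTop (nhds 3) → ∃ (C₁ : ℝ) (v : ℝ → EuclideanSpace ℝ (Fin 3) → EuclideanSpace ℝ (Fin 3)) (R' S' : EuclideanSpace ℝ (Fin 3) ≃ₗᵢ[ℝ] EuclideanSpace ℝ (Fin 3)), Literature.Analysis.FluidPDE.IsAncientMildSolution 1 v ∧ (∀ t : ℝ, t < 0 → MeasureTheory.AEStronglyMeasurable (v t) MeasureTheory.volume) ∧ Literature.Analysis.FluidPDE.HasTypeIDecay C₁ v ∧ (¬ ∀ t : ℝ, t < 0 → v t =ᵐ[MeasureTheory.volume] 0) ∧ Literature.Analysis.FluidPDE.IsRotatedDSS 2 R' v ∧ Literature.Analysis.FluidPDE.IsRotatedDSS 3 S' v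

/-- item stmt-NavierStokesRegularity-27745 · support · rank 9 · closed · proved by Summit.NavierStokesRegularity.NavierStokesRegularity.Theorems.RootDecompFactorLadderRepresentative.typeIRdssRepresentative_holds (planner) · by planner
[support] REG «CLASSICAL PINNED REPRESENTATIVE» (lens-1 g17 FAKE BREATHER repair kit, critic row
208: EXPECTED THEOREM, ATTACKABLE NOW, first prover target of N26 rev 3; load-bearing binder of the
repaired closes (hK hREG hA hBR)): every member of W's class (ancient mild ν = 1 in duality form,
measurable slices on t < 0, (c,R)-rotated-DSS with c > 1, Type-I envelope) is slice-wise a.e. on the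
past equal to a member V of the SAME class which is jointly continuous on the open past and vanishes
on t ≥ 0, with the same (c,R)-RDSS symmetry. Route to a proof: Type-I ⟹ bounded on every (−∞, −δ);
bounded ancient mild solutions are smooth on the past (KNSS 2009 §4, Rem. 4.1 / §6;
Fabes–Jones–Rivière 1972 Thm 2.1, tree classical_of_smooth_isMildNSSolutionOn_holds pattern of
TypeIAncientMildClassical.lean); pass the RDSS identity to the continuous representative by
Continuous.ae_eq_iff_eq, the Type-I bound by continuity, the class by past-only congruence
(isAncientMildSolution_congr), cut off at t ≥ 0 (isRotatedDSS_of_Iio_of_eq_zero). CONSISTENT: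
implied by W 29252 with V := 0 (writer Sketch reg_of_wall). Why it might fail: only through the
Bochner-junk reading of IsAncientMildSolution (slice -/
@[route_item "route-NavierStokesRegularity-RootDecompFactorLadder", crux]
def TypeIRdssRepresentative : Prop :=
  ∀ (c : ℝ) (R : EuclideanSpace ℝ (Fin 3) ≃ₗᵢ[ℝ] EuclideanSpace ℝ (Fin 3)) (u : ℝ → EuclideanSpace ℝ (Fin 3) → EuclideanSpace ℝ (Fin 3)), 1 < c → Literature.Analysis.FluidPDE.IsAncientMildSolution 1 u → (∀ t : ℝ, t < 0 → MeasureTheory.AEStronglyMeasurable (u t) MeasureTheory.volume) → Literature.Analysis.FluidPDE.IsRotatedDSS c R u → (∃ C₀ : ℝ, Literature.Analysis.FluidPDE.HasTypeIDecay C₀ u) → ∃ V : ℝ → EuclideanSpace ℝ (Fin 3) → EuclideanSpace ℝ (Fin 3), (∀ t : ℝ, t < 0 → V t =ᵐ[MeasureTheory.volume] u t) ∧ Literature.Analysis.FluidPDE.IsAncientMildSolution 1 V ∧ (∀ t : ℝ, t < 0 → MeasureTheory.AEStronglyMeasurable (V t) MeasureTheory.volume) ∧ ContinuousOn (Function.uncurry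 V) (Set.Iio 0 ×ˢ Set.univ) ∧ (∀ t : ℝ, 0 ≤ t → V t = 0) ∧ Literature.Analysis.FluidPDE.IsRotatedDSS c R V ∧ ∃ C₀ : ℝ, Literature.Analysis.FluidPDE.HasTypeIDecay C₀ V

-- `TypeIRdssRepresentative` holds: proved by `Summit.NavierStokesRegularity.NavierStokesRegularity.Theorems.RootDecompFactorLadderRepresentative.typeIRdssRepresentative_holds` (its module imports this route file, so no `_holds` link can be stated here).

/-- item stmt-NavierStokesRegularity-33312 · support · rank 9 · open · by planner
why it might fail: it inherits the lineage's open items NMT and PER (and N4's blocker 1217 behind them); nothing new is claimed here.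
sources: arXiv:1610.05680
[support] N15's other `closes` binders BY NAME (no new content; bundled so that `closes` has three
load-bearing binders): R `MarginalReduction` (25947, PROVED in tree) ∧ LBE `LeanBadDatumExists`
(29109, PROVED) ∧ NMT `LeanThresholdIsTypeI` (29108; on N14 via N ∧ E) ∧ PER
`ThresholdTangentPeriodicity` (29251; replaced on N18 by TAN ∧ DSS♭ ∧ ISO) — items of
route-NavierStokesRegularity-RootDecompThresholdSaddle / -RootDecompPointVertex, staffed THERE.
[difficulty: XL] -/
@[route_item "route-NavierStokesRegularity-RootDecompFactorLadder", crux]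
def ThresholdSaddleConeRest : Prop :=
  Summit.NavierStokesRegularity.NavierStokesRegularity.Theses.RootDecompThresholdSaddle.MarginalReduction ∧ Summit.NavierStokesRegularity.NavierStokesRegularity.Theses.RootDecompThresholdSaddle.LeanBadDatumExists ∧ Summit.NavierStokesRegularity.NavierStokesRegularity.Theses.RootDecompThresholdSaddle.LeanThresholdIsTypeI ∧ Summit.NavierStokesRegularity.NavierStokesRegularity.Theses.RootDecompThresholdSaddle.ThresholdTangentPeriodicity

/-- item stmt-NavierStokesRegularity-33313 · aside · rank 9 · open · by planner
why it might fail: the horn sectors' compactness limit is a MIDDLE-SPEED soliton — NEAR at full strength is exactly as hard as A there (S makes this precise); without A no rotation-blind gap is known.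
sources: arXiv:1610.09464, arXiv:2607.09619
[support] NEAR [aside] ROTATION-BLIND NEAR-IDENTITY GAP (rung; EXPECTED THEOREM modulo A via S;
PROVED sub-cells R = 1 (Chae–Wolf 2017 Thm 1.3), PV 2026 Thm 1.7 wedge/disc, envelopes C₀⁴ <
1024/27): for every envelope constant C₀ there is a threshold Λ > 1 such that no Type-I (constant
C₀) ancient mild member is (c,R)-rotated-DSS with 1 < c < Λ, WHATEVER R ∈ O(3). W ⟺ NEAR ∧ B (lens
`wall_iff_gap_and_isolated`); NEAR ⟹ A (logic, `accumulating_of_gap`); first OPEN rung = the horn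
sectors α₁S < |θ| < α₂S, S = 2 log c ↓ 0. [difficulty: XL] -/
@[route_item "route-NavierStokesRegularity-RootDecompFactorLadder"]
def NearIdentityGap : Prop :=
  ∀ C₀ : ℝ, ∃ Λ : ℝ, 1 < Λ ∧ (∀ (c : ℝ) (R : EuclideanSpace ℝ (Fin 3) ≃ₗᵢ[ℝ] EuclideanSpace ℝ (Fin 3)) (u : ℝ → EuclideanSpace ℝ (Fin 3) → EuclideanSpace ℝ (Fin 3)), 1 < c → c < Λ → Literature.Analysis.FluidPDE.IsAncientMildSolution 1 u → (∀ t : ℝ, t < 0 → MeasureTheory.AEStronglyMeasurable (u t) MeasureTheory.volume) → Literature.Analysis.FluidPDE.IsRotatedDSS c R u → Literature.Analysis.FluidPDE.HasTypeIDecay C₀ u → ∀ t : ℝ, t < 0 → u t =ᵐ[MeasureTheory.volume] 0)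

/-- item stmt-NavierStokesRegularity-33314 · aside · rank 9 · open · by planner
why it might fail: nontriviality of the extracted limit needs a uniform lower bound at unit scale (Chae–Wolf Step 1 uses ε-regularity at the DSS scale, which degenerates as c_n ↓ 1 unless windows are re-chosen — the tree's window extraction handles R = tuned rotations only).
sources: arXiv:1610.09464, arXiv:2607.09619
[support] S [aside] GAP TRANSFER (EXPECTED THEOREM, ATTACKABLE NOW — second prover target): A ⟹
NEAR. Road: re-run the tree's rotated-DSS compactness extraction (`exists_limit_rdss_tuned`,
`typeI_rotatedDSS_structure_of_tendsto`, `exists_subseq_window_tendsto`) with ARBITRARY R_n ∈ O(3)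
and NO angle tuning: if NEAR fails at C₀ there are nontrivial members with factors c_n ↓ 1; the
limit's factor set accumulates (powers c_n^(k_n) → μ for every μ > 1, rotations extracted in compact
O(3), diagonal over countable dense μ, closedness of the RDSS relation under local convergence),
nontriviality as in Chae–Wolf Step 1, rotoreflections by O(3)-covariance; A kills the limit. [deps:
AccumulatingFactorLiouville, NearIdentityGap] [difficulty: L] -/
@[route_item "route-NavierStokesRegularity-RootDecompFactorLadder"]
def GapTransfer : Prop :=
  AccumulatingFactorLiouville → NearIdentityGap

/-- item stmt-NavierStokesRegularity-33315 · aside · rank 9 · open · by planner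
why it might fail: only the transport ancient-mild Type-I ⟹ classical on (−∞,0) × ℝ³ with the same envelope stands between the tree's Chae–Wolf theorem and this typing; a gap in that transport (measurable-slice hypothesis too weak for the mild formulation) would force a restatement.
sources: arXiv:1610.09464
[support] FLOOR [aside] PURE-DSS NEAR GAP (KNOWN — FIRST PROVER TARGET, bc5 witness of NEAR): for
every C₀ there is Λ > 1 such that no Type-I (constant C₀) ancient mild member with measurable slices
is c-DSS (R = 1) with 1 < c < Λ — Chae–Wolf 2017 Thm 1.3 (`chaeWolf2017_removing_dss_holds`,
classical typing) transported to the ancient-mild typing of W (`TypeIAncientMildClassical`). NEAR ⟹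
FLOOR (`pureDssNearGap_of_gap`). [difficulty: M] -/
@[route_item "route-NavierStokesRegularity-RootDecompFactorLadder"]
def PureDssNearGap : Prop :=
  ∀ C₀ : ℝ, ∃ Λ : ℝ, 1 < Λ ∧ ∀ (c : ℝ) (u : ℝ → EuclideanSpace ℝ (Fin 3) → EuclideanSpace ℝ (Fin 3)), 1 < c → c < Λ → Literature.Analysis.FluidPDE.IsAncientMildSolution 1 u → (∀ t : ℝ, t < 0 → MeasureTheory.AEStronglyMeasurable (u t) MeasureTheory.volume) → Literature.Analysis.FluidPDE.IsDiscretelySelfSimilar c u → Literature.Analysis.FluidPDE.HasTypeIDecay C₀ u → ∀ t : ℝ, t < 0 → u t =ᵐ[MeasureTheory.volume] 0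

/-- item stmt-NavierStokesRegularity-33316 · aside · rank 9 · open · by planner
why it might fail: routine modulo the classical ⟹ ancient-mild transport and the decay normalisation (1.9) of PV's conjecture; the only risk is a mismatch between CoriolisHead's profile class and the Type-I envelope class of A (profile decay vs envelope constant).
sources: arXiv:2607.09619
[support] T♭ [aside] FACTOR ⟹ CORIOLIS (ATTACKABLE NOW): A implies CoriolisHead's crux
`NoCoRotatingCore` (stmt-22676): a rotated self-similar profile field pvAnsatz α U is (c, rotZ(2α
log c))-RDSS for EVERY c > 1 (`isRotatedDSS_pvAnsatz`), hence has an accumulating factor set;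
classical Type-I ⟹ ancient mild (tree transport); then `noCoRotatingCore_of_pineauVicolConjecture`.
With the converse T♯ (Cartan closed-subgroup lemma for ℝ₊ × O(3), library gap) A ≡ 22676. [deps:
AccumulatingFactorLiouville] [difficulty: M] -/
@[route_item "route-NavierStokesRegularity-RootDecompFactorLadder"]
def FactorToCoriolis : Prop :=
  AccumulatingFactorLiouville → Summit.NavierStokesRegularity.NavierStokesRegularity.Theses.CoriolisHead.NoCoRotatingCore

/-- item stmt-NavierStokesRegularity-33317 · assembly · rank 1 · open · by planner
[assembly] N15's remainder, A and B imply Clay (A). -/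
@[route_item "route-NavierStokesRegularity-RootDecompFactorLadder"]
def Assembly : Prop :=
  ThresholdSaddleConeRest → TypeIRdssRepresentative → AccumulatingFactorLiouville → PastIsolatedFactorLiouville → NavierStokesRegularity

/-! D-0027 §2.1 — DECIDING THEOREM (planner-authored via `route open/edit --closes-file`; by planner-decomp-ns-writer-1-g7-0 2026-08-30T18:12:36Z):
its hypotheses are this route's items and its conclusion the sub-problem Statement (glue_lint), and it elaborates with this file. -/

@[closes "route-NavierStokesRegularity-RootDecompFactorLadder"] theorem closes (hK : ThresholdSaddleConeRest) (hREG : TypeIRdssRepresentative) (hA : AccumulatingFactorLiouville) (hBR : PastIsolatedFactorLiouville) : NavierStokesRegularity :=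
  Summit.NavierStokesRegularity.NavierStokesRegularity.Theses.RootDecompThresholdSaddle.closes hK.1 hK.2.1 hK.2.2.1 hK.2.2.2 (by
    have hrot : ∀ (c : ℝ) (R : EuclideanSpace ℝ (Fin 3) ≃ₗᵢ[ℝ] EuclideanSpace ℝ (Fin 3)),
        Literature.Analysis.FluidPDE.RotatedTypeIDSSLiouville c R := by
      intro c R hc u hm hme hR hd t ht
      obtain ⟨V, hVu, hVm, hVme, hVc, hV0, hVR, hVd⟩ := hREG c R u hc hm hme hR hd
      refine (hVu t ht).symm.trans ?_
      by_cases hacc : ∀ ε : ℝ, 0 < ε → ∃ (c' : ℝ) (R' : EuclideanSpace ℝ (Fin 3) ≃ₗᵢ[ℝ] EuclideanSpace ℝ (Fin 3)),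
          1 < c' ∧ c' < 1 + ε ∧ Literature.Analysis.FluidPDE.IsRotatedDSS c' R' V
      · exact hA V hVm hVme hVd hacc t ht
      · simp only [not_forall, not_exists, not_and] at hacc
        obtain ⟨ε, hε, hno⟩ := hacc
        exact hBR c R V hc hVm hVme hVc hV0 hVR hVd ⟨1 + ε, by linarith, fun c' R' h1 h2 => hno c' R' h1 h2⟩ t ht
    exact fun c => ⟨(Literature.Analysis.FluidPDE.rotatedTypeIDSSLiouville_refl_iff c).1 (hrot c _), hrot c⟩)

end Summit.NavierStokesRegularity.NavierStokesRegularity.Theses.RootDecompFactorLadder
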